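import Literature.AnabelianGeometry.SemiGraphs.SubgraphComponentsDoubleCosetsOfPorts
import Literature.AnabelianGeometry.SemiGraphs.PortOfEssentialCell
import HarnessLib

/-!
# (D3) `covering_subgraphComponents_doubleCosets` WITHOUT branch alignment — CLASS CLOSER ASSEMBLY: bases each of whose edge-cells is non-separating or essential on both sides ([SemiAnbd] Cor. 2.7 (i) p. 30)

Mochizuki, *Semi-graphs of anabelioids*, Publ. RIMS **42** (2006), §2, proof of Cor. 2.7 (i) p. 30
("[as one verifies immediately] `ℋ′` injects into `𝒢′` as a subgraph"; the two sheets `ℋ″`,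
`g · ℋ″` of a connected finite Galois étale covering) [cite: MochizukiSemiAnbd2006, Cor. 2.7(i) p.30];
Def. 2.2 (i) p. 23 (the cells of the covering semi-graph), Rem. 2.2.1 p. 24 (decomposition groups =
stabilisers).

PROOF-ONLY (abc-iut cell, layer L3; FACT-LIST row F-1487 `covering_subgraphComponents_doubleCosets`
AS TYPED — local ∧ global ∧ vertex-aligned, NO branch alignment —, CLASS route «regluing invisibility»
of abc-iut-w4-d080, brick R6 ASSEMBLY «B3 ∘ (per-cell non-separating ∨ D3)»; seat abc-iut-f-161
(gen 13), tranche 161).  Over the PORT-CLASS CLOSER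
(`covering_subgraphComponents_doubleCosets_of_connectedPorts`, B3) and the two PORT PRODUCERS — the
trivial port `(A, 𝟙_A)` of a two-sided non-separating cell of `𝔾_A` (B3's `BObj.ports_of_nonSeparating`,
here ONE CELL AT A TIME) and R6a `BObj.port_of_essential` (an edge-cell ESSENTIAL ON BOTH SIDES has a
two-sided non-separating port at some Galois level):

* `BObj.port_of_nonSeparating_cell` — a two-sided non-separating branch-cell `bc₀` of `𝔾_A` is a port
  for its own edge-cell: the `hport` clause of the port-class closer at `(e(bc₀), Q(bc₀))` with
  `Y = A`, `g = 𝟙_A`;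
* `covering_subgraphComponents_doubleCosets_of_essentialCells` — **THE CLASS CLOSER, ASSEMBLED: the body
  of F-1487 AS TYPED for EVERY covering of every connected `(𝒢, A)` each of whose edge-cells `(e, Q)`
  is EITHER carried by a two-sided non-separating branch-cell of `𝔾_A` OR essential on both sides** (at
  a point over `Q` on the `b₀`-side and at a point over `Q` on the `b₁`-side, `e = {b₀, b₁}`, each in a
  `LevelEdgesOfObject` frame `(v, F, F_e, α)`: some element of `Π_v` fixes the point but does not map
  into the edge group `D_b ≤ Π`) — a condition on `(𝒢, A)` alone, with no Galois level to be named by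
  the user.

What is NOT here: OPEN edge-cells (a branch abutting to no vertex: never two-sided, never essential in a
frame — the class excludes bases with open edges carrying `A`-cells; R6c, the localised tie) and
separating cells with an inessential (HAIR) side (R7).  CLASS-route closer (R6a/R6b assembled):
F-1487 AS TYPED stays OPEN-AS-TYPED (L3-lead δ22); CLASS CLOSER ≠ the fact; typed ≠ proved; no
definition, no instance, no new named fact; nothing here takes a side on [IUTchIII] Cor. 3.12.
-/

namespace Literature.AnabelianGeometry.SemiGraphs

namespace SemiGraphOfAnabelioids

open CategoryTheory CategoryTheory.Limits CategoryTheory.Functor CategoryTheory.PreGaloisCategory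
open Literature.AnabelianGeometry.Anabelioids
open scoped Pointwise

universe v₁ u₁ u

variable {𝒢 𝒢' : SemiGraphOfAnabelioids.{v₁, u₁, u}}

/-- **A two-sided non-separating branch-cell is a port for its own edge-cell** ([SemiAnbd] Def. 2.2 (i)
p. 23: the cells of `𝔾_A`; the trivial level `Y = A`).  If the branch-cell `bc₀ = (b₀, Q)` of `𝔾_A`
abuts to `vc₀`, the other branch-cell `bc₁` of its edge-cell abuts to `vc₁`, and `vc₁` is reachable from
`vc₀` by incidences of `𝔾_A` avoiding `bc₀`, then — `A` being connected — the `hport` clause of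
`covering_subgraphComponents_doubleCosets_of_connectedPorts` holds at the edge-cell `(e(b₀), Q)` with
`Y := A`, `g := 𝟙_A`, port `bc₀` (B3's `BObj.ports_of_nonSeparating`, one cell at a time).
[cite: MochizukiSemiAnbd2006, Def. 2.2(i) p.23] -/
theorem BObj.port_of_nonSeparating_cell (A : 𝒢.BObj) (hA : PreGaloisCategory.IsConnected A)
    (bc₀ : A.fibreData.total.Branch) {vc₀ vc₁ : A.fibreData.total.Vertex}
    {bc₁ : A.fibreData.total.Branch}
    (h₀ : A.fibreData.total.abuts bc₀ = some vc₀) (h₁ : A.fibreData.total.abuts bc₁ = some vc₁)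
    (hne : bc₁ ≠ bc₀) (he : A.fibreData.total.edgeOf bc₁ = A.fibreData.total.edgeOf bc₀)
    (hreach : Relation.ReflTransGen
      (fun x y : A.fibreData.total.Vertex => ∃ bc bc' : A.fibreData.total.Branch,
        bc ≠ bc₀ ∧ bc' ≠ bc₀ ∧ A.fibreData.total.edgeOf bc = A.fibreData.total.edgeOf bc' ∧
          A.fibreData.total.abuts bc = some x ∧ A.fibreData.total.abuts bc' = some y) vc₀ vc₁) :
    ∃ (Y : 𝒢.BObj) (_ : PreGaloisCategory.IsConnected Y) (g : Y ⟶ A)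
      (bc : Y.fibreData.total.Branch) (vc₀ vc₁ : Y.fibreData.total.Vertex)
      (bc₁ : Y.fibreData.total.Branch),
      Y.fibreData.total.abuts bc = some vc₀ ∧ Y.fibreData.total.abuts bc₁ = some vc₁ ∧
      bc₁ ≠ bc ∧ Y.fibreData.total.edgeOf bc₁ = Y.fibreData.total.edgeOf bc ∧
      Relation.ReflTransGen
        (fun x y : Y.fibreData.total.Vertex => ∃ b b' : Y.fibreData.total.Branch,
          b ≠ bc ∧ b' ≠ bc ∧ Y.fibreData.total.edgeOf b = Y.fibreData.total.edgeOf b' ∧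
            Y.fibreData.total.abuts b = some x ∧ Y.fibreData.total.abuts b' = some y) vc₀ vc₁ ∧
      ∃ (Q' : π₀Obj (A.T (𝒢.graph.edgeOf (Y.fibreData.proj.branchMap bc)))),
        (⟨𝒢.graph.edgeOf (Y.fibreData.proj.branchMap bc), Q'⟩ : Σ e, π₀Obj (A.T e)) =
          ⟨𝒢.graph.edgeOf (A.fibreData.proj.branchMap bc₀), A.brComp bc₀⟩ ∧
        ∃ k : ((Y.brComp bc).1 : 𝒢.E (𝒢.graph.edgeOf (Y.fibreData.proj.branchMap bc))) ⟶
            (Q'.1 : 𝒢.E (𝒢.graph.edgeOf (Y.fibreData.proj.branchMap bc))),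
          k ≫ Q'.1.arrow = (Y.brComp bc).1.arrow ≫ g.fT (𝒢.graph.edgeOf (Y.fibreData.proj.branchMap bc)) := by
  refine ⟨A, hA, 𝟙 A, bc₀, vc₀, vc₁, bc₁, h₀, h₁, hne, he, hreach, A.brComp bc₀, rfl, 𝟙 _, ?_⟩
  rw [BObj.id_fT, Category.id_comp, Category.comp_id]

/-- **THE CLASS CLOSER, ASSEMBLED — (D3) AS TYPED over bases each of whose edge-cells is non-separating
or essential on both sides** ([SemiAnbd] Cor. 2.7 (i) p. 30, "`ℋ′` injects into `𝒢′` as a subgraph";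
Def. 2.2 (i) p. 23 at the TYPED notion of morphism: local ∧ global ∧ vertex-aligned, NO branch
alignment).  Let `𝒢` be connected and `A ∈ B(𝒢)`; assume that EVERY edge-cell `(e, Q)` of `𝔾_A`
satisfies ONE of: (NS) some branch-cell `bc₀` of `𝔾_A` over `(e, Q)` abuts to a vertex-cell `vc₀`, the
other branch-cell of the edge-cell abuts to `vc₁`, and `vc₁` is reachable from `vc₀` by incidences of
`𝔾_A` avoiding `bc₀` (two-sided and NON-SEPARATING); (ESS) `e = {b₀, b₁}` with `b₀ ∋ v₁`, `b₁ ∋ v₂`,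
and in frames `(v₁, F₁, F_e, α₁)`, `(v₂, F₂, F_e′, α₂)` there are points `a₁ ∈ F₁(A_{v₁})`,
`a₂ ∈ F₂(A_{v₂})` over the cell `Q` at which the respective side is ESSENTIAL (some element of the vertex
group fixes the point and does not map into the edge group `D_b ≤ Π`).  Then EVERY `φ : 𝒢′ → 𝒢` from a
connected `𝒢′` which is locally and globally the covering attached to `A` and vertex-aligned satisfies
the body of `covering_subgraphComponents_doubleCosets` ((P1) preimage components of `ℍ` ↔
`Π_ℍ \ Π_𝒢 / Π′`, (P2) the component through `v′` exists, (P3) it goes to the class of `Π′` with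
`ι(Π_{K₀}) = Π′ ∩ Π_ℍ`, (P4) `ι(Π_K) = Π′ ∩ g⁻¹ Π_ℍ g`).  Proof: cell by cell, (NS) ⇒ the trivial port
(`BObj.port_of_nonSeparating_cell`; `A` is connected by the global clause), (ESS) ⇒ R6a
`BObj.port_of_essential`; then B3 `covering_subgraphComponents_doubleCosets_of_connectedPorts`.  CLASS
CLOSER only: the typed fact, which quantifies over all `(𝒢, A)`, is not asserted; OPEN edge-cells and
HAIR sides are outside the class. [cite: MochizukiSemiAnbd2006, Cor. 2.7(i) p.30] -/
theorem covering_subgraphComponents_doubleCosets_of_essentialCells :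
    ∀ (𝒢 𝒢' : SemiGraphOfAnabelioids.{v₁, u₁, u}) (φ : Hom 𝒢' 𝒢) (A : 𝒢.BObj),
      𝒢.IsConnected → 𝒢'.IsConnected → φ.IsFiniteEtaleCoveringOf A → φ.IsGlobalCoveringOf A →
      φ.IsVertexAligned →
      (∀ (e : 𝒢.graph.Edge) (Q : π₀Obj (A.T e)),
        (∃ (bc₀ : A.fibreData.total.Branch) (vc₀ vc₁ : A.fibreData.total.Vertex)
            (bc₁ : A.fibreData.total.Branch),
          (⟨𝒢.graph.edgeOf (A.fibreData.proj.branchMap bc₀), A.brComp bc₀⟩ : Σ e, π₀Obj (A.T e)) =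
            ⟨e, Q⟩ ∧
          A.fibreData.total.abuts bc₀ = some vc₀ ∧ A.fibreData.total.abuts bc₁ = some vc₁ ∧
          bc₁ ≠ bc₀ ∧ A.fibreData.total.edgeOf bc₁ = A.fibreData.total.edgeOf bc₀ ∧
          Relation.ReflTransGen
            (fun x y : A.fibreData.total.Vertex => ∃ bc bc' : A.fibreData.total.Branch,
              bc ≠ bc₀ ∧ bc' ≠ bc₀ ∧ A.fibreData.total.edgeOf bc = A.fibreData.total.edgeOf bc' ∧
                A.fibreData.total.abuts bc = some x ∧ A.fibreData.total.abuts bc' = some y) vc₀ vc₁) ∨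
        (∃ (v₁ : 𝒢.graph.Vertex) (F₁ : 𝒢.V v₁ ⥤ FintypeCat.{v₁}) (_ : FiberFunctor F₁)
            (b₀ : 𝒢.graph.Branch) (h₀ : 𝒢.graph.abuts b₀ = some v₁)
            (Fe : 𝒢.E (𝒢.graph.edgeOf b₀) ⥤ FintypeCat.{v₁}) (_ : FiberFunctor Fe)
            (α₁ : (𝒢.pull b₀ v₁ h₀).pullback ⋙ Fe ≅ F₁) (Q₀ : π₀Obj (A.T (𝒢.graph.edgeOf b₀)))
            (_ : (⟨𝒢.graph.edgeOf b₀, Q₀⟩ : Σ e, π₀Obj (A.T e)) = ⟨e, Q⟩)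
            (a₁ : F₁.obj (A.S v₁))
            (_ : Fe.map (A.ψ b₀ v₁ h₀).hom (α₁.inv.app (A.S v₁) a₁) ∈ Set.range (Fe.map Q₀.1.arrow))
            (_ : ∃ u : 𝒢.PiV v₁ F₁, u • a₁ = a₁ ∧
              𝒢.piVToPi v₁ F₁ u ∉ (𝒢.branchSubgroup F₁ b₀ h₀ Fe α₁).map (𝒢.piVToPi v₁ F₁))
            (v₂ : 𝒢.graph.Vertex) (F₂ : 𝒢.V v₂ ⥤ FintypeCat.{v₁}) (_ : FiberFunctor F₂)
            (b₁ : 𝒢.graph.Branch) (_ : b₁ ≠ b₀) (h₁ : 𝒢.graph.abuts b₁ = some v₂)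
            (Fe' : 𝒢.E (𝒢.graph.edgeOf b₁) ⥤ FintypeCat.{v₁}) (_ : FiberFunctor Fe')
            (α₂ : (𝒢.pull b₁ v₂ h₁).pullback ⋙ Fe' ≅ F₂) (Q₁ : π₀Obj (A.T (𝒢.graph.edgeOf b₁)))
            (_ : (⟨𝒢.graph.edgeOf b₁, Q₁⟩ : Σ e, π₀Obj (A.T e)) = ⟨𝒢.graph.edgeOf b₀, Q₀⟩)
            (a₂ : F₂.obj (A.S v₂))
            (_ : Fe'.map (A.ψ b₁ v₂ h₁).hom (α₂.inv.app (A.S v₂) a₂) ∈ Set.range (Fe'.map Q₁.1.arrow)),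
            ∃ u : 𝒢.PiV v₂ F₂, u • a₂ = a₂ ∧
              𝒢.piVToPi v₂ F₂ u ∉ (𝒢.branchSubgroup F₂ b₁ h₁ Fe' α₂).map (𝒢.piVToPi v₂ F₂))) →
      ∀ (v' : 𝒢'.graph.Vertex) (F' : 𝒢'.V v' ⥤ FintypeCat.{v₁}) [FiberFunctor F']
        (F : 𝒢.V (φ.base.vertexMap v') ⥤ FintypeCat.{v₁}) [FiberFunctor F]
        (e : (φ.φV v').pullback ⋙ F' ≅ F)
        (H : 𝒢.graph.Subgraph), H.toSemiGraph.IsConnected → H.toSemiGraph.IsGraph →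
        ∀ (hv : φ.base.vertexMap v' ∈ H.verts),
        let v := φ.base.vertexMap v'
        let ι : 𝒢'.Pi v' F' →* 𝒢.Pi v F :=
          (Aut.autMulEquivOfIso (Functor.isoWhiskerLeft (𝒢.ρ v) e)).toMonoidHom.comp
            (pi1Map φ.pullbackFunctor (𝒢'.ρ v' ⋙ F'))
        let PH : Subgroup (𝒢.Pi v F) := (𝒢.piHToPi H ⟨v, hv⟩ F).range
        ∀ x₀ : (𝒢.ρ v ⋙ F).obj A, ι.range = MulAction.stabilizer (𝒢.Pi v F) x₀ →
          ∃ d : {K : 𝒢'.graph.Subgraph // φ.IsPreimageComponent H K} → 𝒢.Pi v F,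
            Function.Bijective (fun K => DoubleCoset.mk PH ι.range (d K)) ∧
            (∃ K₀ : {K : 𝒢'.graph.Subgraph // φ.IsPreimageComponent H K}, v' ∈ K₀.1.verts) ∧
            (∀ (K : {K : 𝒢'.graph.Subgraph // φ.IsPreimageComponent H K}) (hK : v' ∈ K.1.verts),
              d K ∈ ι.range ∧ (ι.comp (𝒢'.piHToPi K.1 ⟨v', hK⟩ F')).range = ι.range ⊓ PH) ∧
            ∀ (K : {K : 𝒢'.graph.Subgraph // φ.IsPreimageComponent H K})
              (w'' : K.1.toSemiGraph.Vertex) (F'' : 𝒢'.V w''.1 ⥤ FintypeCat.{v₁}) [FiberFunctor F'']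
              (α : 𝒢'.ρ w''.1 ⋙ F'' ≅ 𝒢'.ρ v' ⋙ F'),
              ∃ g : 𝒢.Pi v F,
                (ι.comp ((Aut.autMulEquivOfIso α).toMonoidHom.comp (𝒢'.piHToPi K.1 w'' F''))).range =
                  ι.range ⊓ ConjAct.toConjAct g⁻¹ • PH := by
  intro 𝒢 𝒢' φ A h𝒢 h𝒢' hloc hB hva hcells
  refine covering_subgraphComponents_doubleCosets_of_connectedPorts 𝒢 𝒢' φ A h𝒢 h𝒢' hloc hB hva ?_
  -- `A` is connected (the global clause, (D8) direction `𝒢′` connected ⇒ `A` connected)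
  have hA : PreGaloisCategory.IsConnected A := isConnected_of_isGlobalCovering h𝒢' φ A hB
  letI := 𝒢.galoisCategory_bObj h𝒢
  intro e Q
  rcases hcells e Q with
    ⟨bc₀, vc₀, vc₁, bc₁, hcell, h₀, h₁, hne, he, hreach⟩ |
    ⟨v₁, F₁, hF₁, b₀, h₀, Fe, hFe, α₁, Q₀, hQ₀, a₁, ha₁, hess₀, v₂, F₂, hF₂, b₁, hb, h₁, Fe', hFe', α₂,
      Q₁, hQ₁, a₂, ha₂, hess₁⟩
  · -- (NS): the trivial port `(A, 𝟙_A)` at the cell itself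
    obtain ⟨Y, hY, g, bc, wc₀, wc₁, bc', h₀', h₁', hne', he', hreach', Q', hQ', hk⟩ :=
      BObj.port_of_nonSeparating_cell A hA bc₀ h₀ h₁ hne he hreach
    exact ⟨Y, hY, g, bc, wc₀, wc₁, bc', h₀', h₁', hne', he', hreach', Q', hQ'.trans hcell, hk⟩
  · -- (ESS): R6a, a port at a Galois level
    haveI := hF₁; haveI := hFe; haveI := hF₂; haveI := hFe'
    haveI : FiberFunctor (𝒢.ρ v₁ ⋙ F₁) := 𝒢.fiberFunctor_ρ h𝒢 v₁ F₁
    haveI : FiberFunctor (𝒢.ρ v₂ ⋙ F₂) := 𝒢.fiberFunctor_ρ h𝒢 v₂ F₂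
    obtain ⟨Y, hY, g, bc, wc₀, wc₁, bc', h₀', h₁', hne', he', hreach', Q', hQ', hk⟩ :=
      BObj.port_of_essential h𝒢 A F₁ b₀ h₀ Fe α₁ Q₀ a₁ ha₁ hess₀ F₂ b₁ hb h₁ Fe' α₂ Q₁ hQ₁ a₂ ha₂ hess₁
    exact ⟨Y, hY, g, bc, wc₀, wc₁, bc', h₀', h₁', hne', he', hreach', Q', hQ'.trans hQ₀, hk⟩

end SemiGraphOfAnabelioids

end Literature.AnabelianGeometry.SemiGraphs
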